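import Summits.BirchSwinnertonDyer.Rank1Residual.GaloisImage.LocalUnitsModPGaloisCount
import Summits.BirchSwinnertonDyer.Rank1Residual.GaloisImage.ModPLatticeHerbrandTorsion
import Summits.BirchSwinnertonDyer.Rank1Residual.GaloisImage.LocalUnitsSubgroup
import HarnessLib

/-!
# `[𝒪_Eˣ/p] − [𝒪_Eˣ[p]] = [𝒪_E/p]`: transfer from the one-units `U_1` to the full unit group
# (cell `b2b-bsdres`, team n1011, row T-EPC = Tate's local Euler–Poincaré characteristic; seat p04 GEN 7; stage B4b)

HONEST FRAMING (cell `b2b-bsdres`, run/shared/lean/b2b/bsd-rank1-residual/, verbatim in every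
file): the goal of the cell is to DELETE the COMBINATION-SHAPED residual classes of the
Birch–Swinnerton-Dyer formula for ALL analytic-rank `≤ 1` elliptic curves over `ℚ` — "full BSD
formula for every rank `≤ 1` curve in class `C`" assembled STRICTLY from published theorems — so
that the rank-`≤ 1` remainder becomes exactly the CONSTRUCTION-SHAPED classes, which are TYPED
(missing-input `Prop`s), NOT attempted. This is not "finishing BSD". Team n1011 (N10 / N11, the
additive block X4 ∧ `p = 3`): research route; no claim beyond the stated classes; nothing is
booked; no mark / label is changed by this file. Theorems only (no definition, no named fact, no
`sorry`); TOOL theorems on local fields.  (Placement: Summits/GaloisImage pending the operator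
move of the T-EPC cone to the Literature homes.)

## What

`E/K` finite Galois, `E` a non-archimedean local field of characteristic `0`, `|p| < 1`,
`Δ = Gal(E/K)`, `p ∤ #Δ`, `Z` a finite `Δ`-module killed by `p`; `OU = 𝒪_Eˣ ≤ Eˣ`,
`U_1 = 1 + p𝒪_E` (stages B1, B4a).  Write `#(𝒪_E/p)ˣ = p^a m'` with `p ∤ m'` and
`U♭ = {u ∈ 𝒪_Eˣ | u^{p^a} ∈ U_1}`.

* `OneUnits.finite_quotient_one` — `U_1/U_1^p` is finite; `finite_quotient_range_lsmul_of_finite`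
  — `W/pW` is finite when `W/W'` and `W'/pW'` are;
* `OneUnits.natCard_modP_flat` — Milne's Lemma 2.12 with torsion (stage A4) for `U♭ ⊇ U_1`
  combined with stage B3: `#Hom_Δ(Z, U♭/p) = #Hom_Δ(Z, 𝒪_E/p) · #Hom_Δ(Z, U♭[p])`.

The prime-to-`p` transfer `𝒪_Eˣ ⊇ U♭` (Bezout) completing
`#Hom_Δ(Z, 𝒪_Eˣ/p) = #Hom_Δ(Z, 𝒪_E/p) · #Hom_Δ(Z, 𝒪_Eˣ[p])` is stage B4c.

References: J. S. Milne, *Arithmetic Duality Theorems* (2006), I §2, proof of Thm. 2.8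
(Lemmas 2.11–2.12) [MilneADT2006]; J.-P. Serre, *Local Fields*, IV §2 [SerreLocalFields1979].
-/

noncomputable section

open Function
open scoped ValuativeRel

namespace Summit.BirchSwinnertonDyer.Rank1Residual.GaloisImage

namespace OneUnits

open Representation

variable {K : Type*} [Field K] {E : Type*} [Field E] [Algebra K E] [ValuativeRel E]
  [TopologicalSpace E] [IsNonarchimedeanLocalField E]
variable (p : ℕ) [hp : Fact p.Prime]

/-! ### Finiteness -/

section Finiteness

/-- **`U_1/U_1^p` is finite** (kernel and range of the map `U_1/pU_1 → 𝒪_E/p` induced by the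
level-`1` digit are finite: the kernel is the image of the finite `U_2/pU_2`). [folklore] -/
theorem finite_quotient_one [CharZero E] (hpv : ValuativeRel.valuation E p < 1)
    (U₁ U₂ : Submodule ℤ (Additive Eˣ))
    (hU₁ : ∀ u : Additive Eˣ, u ∈ U₁ ↔ ∃ b ∈ 𝒪[E], ((Additive.toMul u : Eˣ) : E) = 1 + (p : E) ^ 1 * b)
    (hU₂ : ∀ u : Additive Eˣ, u ∈ U₂ ↔ ∃ b ∈ 𝒪[E], ((Additive.toMul u : Eˣ) : E) = 1 + (p : E) ^ 2 * b)
    (hU₁st : ∀ σ, U₁ ≤ U₁.comap (Representation.ofMulDistribMulAction (E ≃ₐ[K] E) Eˣ σ))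
    (O : Submodule ℤ E) (hO : ∀ x, x ∈ O ↔ x ∈ 𝒪[E])
    (hOst : ∀ σ, O ≤ O.comap (Representation.ofDistribMulAction ℤ (E ≃ₐ[K] E) E σ)) :
    Finite (U₁ ⧸ LinearMap.range (LinearMap.lsmul ℤ U₁ p)) := by
  classical
  have hp0 : (p : E) ≠ 0 := Nat.cast_ne_zero.2 hp.out.ne_zero
  have hle : U₂ ≤ U₁ := antitone p hpv U₁ U₂ hU₁ hU₂
  have hpW : ∀ w ∈ U₁, (p : ℤ) • w ∈ U₂ := fun w hw => by
    rw [natCast_zsmul]; exact nsmul_mem_succ p hpv le_rfl U₁ U₂ hU₁ hU₂ hw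
  obtain ⟨φ₁, hφ₁s, hφ₁k⟩ := exists_digitHom_level p hpv hp0 le_rfl U₁ U₂ hU₁
    (by simpa only [show (1 : ℕ) + 1 = 2 from rfl] using hU₂) hU₁st O hO hOst (K := K)
  obtain ⟨-, hfinO⟩ := natCard_quotient_two_eq p hpv U₂ hU₂ (E := E)
  haveI := hfinO
  haveI : Finite (O ⧸ LinearMap.range (LinearMap.lsmul ℤ O p)) := by
    refine Nat.finite_of_card_ne_zero ?_
    rw [natCard_quotient_integer_eq p O hO]
    exact Nat.card_pos.ne'
  haveI : Finite (U₂ ⧸ LinearMap.range (LinearMap.lsmul ℤ U₂ p)) := by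
    refine Nat.finite_of_card_ne_zero ?_
    rw [(natCard_quotient_two_eq p hpv U₂ hU₂ (E := E)).1]
    exact Nat.card_pos.ne'
  -- `Ψ : U₁/pU₁ → 𝒪/p`
  have hleker : LinearMap.range (LinearMap.lsmul ℤ U₁ p) ≤ LinearMap.ker φ₁.toLinearMap := by
    rintro _ ⟨u, rfl⟩
    rw [LinearMap.mem_ker]
    change φ₁ ((p : ℤ) • u) = 0
    rw [hφ₁k, Submodule.coe_smul_of_tower]
    exact hpW _ u.2
  let Ψ := (LinearMap.range (LinearMap.lsmul ℤ U₁ p)).liftQ φ₁.toLinearMap hleker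
  -- kernel of `Ψ` = image of `U₂`, a quotient of the finite `U₂/pU₂`
  let ι : U₂ →ₗ[ℤ] U₁ := Submodule.inclusion hle
  have hιp : LinearMap.range (LinearMap.lsmul ℤ U₂ p) ≤
      (LinearMap.range (LinearMap.lsmul ℤ U₁ p)).comap ι := by
    rintro _ ⟨u, rfl⟩
    exact ⟨ι u, by simp [LinearMap.lsmul_apply]⟩
  let κ := (LinearMap.range (LinearMap.lsmul ℤ U₂ p)).mapQ _ ι hιp
  have hker : ∀ x, Ψ x = 0 → x ∈ LinearMap.range κ := by
    intro x hx
    obtain ⟨u, rfl⟩ := Submodule.mkQ_surjective _ x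
    have hu2 : ((u : U₁) : Additive Eˣ) ∈ U₂ := (hφ₁k u).1 hx
    exact ⟨Submodule.Quotient.mk ⟨_, hu2⟩, rfl⟩
  haveI : Finite (LinearMap.range κ) := Finite.of_surjective _ (LinearMap.surjective_rangeRestrict κ)
  haveI : Finite Ψ.toAddMonoidHom.ker :=
    Finite.of_injective (fun x : Ψ.toAddMonoidHom.ker => (⟨x.1, hker x.1 x.2⟩ : LinearMap.range κ))
      fun a b h => Subtype.ext (congrArg
        (fun t : LinearMap.range κ => (t : U₁ ⧸ LinearMap.range (LinearMap.lsmul ℤ U₁ p))) h)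
  haveI : Finite Ψ.toAddMonoidHom.range := Finite.of_injective _ Subtype.coe_injective
  exact (AddMonoidHom.finite_iff_finite_ker_range Ψ.toAddMonoidHom).2 ⟨inferInstance, inferInstance⟩


omit hp [TopologicalSpace E] [IsNonarchimedeanLocalField E] in
/-- If `W' ≤ W`, `W/W'` is finite and `W'/pW'` is finite then `W/pW` is finite. [folklore] -/
theorem finite_quotient_range_lsmul_of_finite {V : Type*} [AddCommGroup V]
    (W W' : Submodule ℤ V) (hle : W' ≤ W) [Finite (W ⧸ W'.comap W.subtype)]
    [Finite (W' ⧸ LinearMap.range (LinearMap.lsmul ℤ W' p))] :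
    Finite (W ⧸ LinearMap.range (LinearMap.lsmul ℤ W p)) := by
  classical
  let ι : W' →ₗ[ℤ] W := Submodule.inclusion hle
  have hιp : LinearMap.range (LinearMap.lsmul ℤ W' p) ≤
      (LinearMap.range (LinearMap.lsmul ℤ W p)).comap ι := by
    rintro _ ⟨u, rfl⟩
    exact ⟨ι u, by simp [LinearMap.lsmul_apply]⟩
  let κ := (LinearMap.range (LinearMap.lsmul ℤ W' p)).mapQ _ ι hιp
  let H : Submodule ℤ (W ⧸ LinearMap.range (LinearMap.lsmul ℤ W p)) := LinearMap.range κ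
  haveI : Finite H := Finite.of_surjective _ (LinearMap.surjective_rangeRestrict κ)
  -- `W/W' ↠ (W/pW)/H`
  have hleH : W'.comap W.subtype ≤ LinearMap.ker (H.mkQ.comp (LinearMap.range (LinearMap.lsmul ℤ W p)).mkQ) := by
    intro w hw
    rw [LinearMap.mem_ker, LinearMap.comp_apply]
    refine (Submodule.Quotient.mk_eq_zero H).2 ?_
    exact ⟨Submodule.Quotient.mk ⟨(w : V), hw⟩, rfl⟩
  let θ := (W'.comap W.subtype).liftQ _ hleH
  have hθ : Surjective θ := by
    intro y
    obtain ⟨x, rfl⟩ := Submodule.mkQ_surjective H y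
    obtain ⟨w, rfl⟩ := Submodule.mkQ_surjective _ x
    exact ⟨Submodule.Quotient.mk w, rfl⟩
  haveI : Finite ((W ⧸ LinearMap.range (LinearMap.lsmul ℤ W p)) ⧸ H.toAddSubgroup) :=
    Finite.of_surjective θ hθ
  haveI : Finite H.toAddSubgroup := ‹Finite H›
  exact Finite.of_addSubgroup_quotient H.toAddSubgroup

end Finiteness

/-! ### `U♭ = {u ∈ 𝒪_Eˣ | u^{p^a} ∈ U_1}` and Milne's Lemma 2.12 for `U♭ ⊇ U_1` -/

section Flat

omit hp [ValuativeRel E] [TopologicalSpace E] [IsNonarchimedeanLocalField E] in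
/-- `U♭` is `Gal(E/K)`-stable. [folklore] -/
theorem flat_le_comap (OU U₁ Ub : Submodule ℤ (Additive Eˣ)) {a : ℕ}
    (hUb : ∀ u : Additive Eˣ, u ∈ Ub ↔ u ∈ OU ∧ p ^ a • u ∈ U₁)
    (hOUst : ∀ σ, OU ≤ OU.comap (Representation.ofMulDistribMulAction (E ≃ₐ[K] E) Eˣ σ))
    (hU₁st : ∀ σ, U₁ ≤ U₁.comap (Representation.ofMulDistribMulAction (E ≃ₐ[K] E) Eˣ σ))
    (σ : E ≃ₐ[K] E) :
    Ub ≤ Ub.comap (Representation.ofMulDistribMulAction (E ≃ₐ[K] E) Eˣ σ) := by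
  intro u hu
  obtain ⟨h1, h2⟩ := (hUb u).1 hu
  rw [Submodule.mem_comap, hUb]
  refine ⟨hOUst σ h1, ?_⟩
  rw [← map_nsmul]
  exact hU₁st σ h2

variable [FiniteDimensional K E]

/-- **`#Hom_Δ(Z, U♭/p) = #Hom_Δ(Z, 𝒪_E/p) · #Hom_Δ(Z, U♭[p])`** for
`U♭ = {u ∈ 𝒪_Eˣ | u^{p^a} ∈ U_1}`: Milne's Lemma 2.12 with torsion (stage A4) for `U♭ ⊇ U_1 ⊇ (U♭)^{p^a}`
and stage B3 for `U_1`, after cancelling `#Hom_Δ(Z, U_1[p]) > 0`.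
[cite: MilneADT2006, I §2 proof of Thm 2.8 (Lemma 2.12, p. 34)] -/
theorem natCard_modP_flat [CharZero E] (hpv : ValuativeRel.valuation E p < 1)
    (hG : ¬ p ∣ Nat.card (E ≃ₐ[K] E))
    {Z : Type*} [AddCommGroup Z] [Finite Z] (σZ : Representation ℤ (E ≃ₐ[K] E) Z)
    (hZ : ∀ z : Z, p • z = 0)
    (U₁ U₂ U₃ OU Ub : Submodule ℤ (Additive Eˣ)) {a : ℕ}
    (hU₁ : ∀ u : Additive Eˣ, u ∈ U₁ ↔ ∃ b ∈ 𝒪[E], ((Additive.toMul u : Eˣ) : E) = 1 + (p : E) ^ 1 * b)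
    (hU₂ : ∀ u : Additive Eˣ, u ∈ U₂ ↔ ∃ b ∈ 𝒪[E], ((Additive.toMul u : Eˣ) : E) = 1 + (p : E) ^ 2 * b)
    (hU₃ : ∀ u : Additive Eˣ, u ∈ U₃ ↔ ∃ b ∈ 𝒪[E], ((Additive.toMul u : Eˣ) : E) = 1 + (p : E) ^ 3 * b)
    (hOU : ∀ u : Additive Eˣ, u ∈ OU ↔
      ((Additive.toMul u : Eˣ) : E) ∈ 𝒪[E] ∧ (((Additive.toMul u)⁻¹ : Eˣ) : E) ∈ 𝒪[E])
    (hUb : ∀ u : Additive Eˣ, u ∈ Ub ↔ u ∈ OU ∧ p ^ a • u ∈ U₁)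
    (hU₁st : ∀ σ, U₁ ≤ U₁.comap (Representation.ofMulDistribMulAction (E ≃ₐ[K] E) Eˣ σ))
    (hU₂st : ∀ σ, U₂ ≤ U₂.comap (Representation.ofMulDistribMulAction (E ≃ₐ[K] E) Eˣ σ))
    (hUbst : ∀ σ, Ub ≤ Ub.comap (Representation.ofMulDistribMulAction (E ≃ₐ[K] E) Eˣ σ))
    (O : Submodule ℤ E) (hO : ∀ x, x ∈ O ↔ x ∈ 𝒪[E])
    (hOst : ∀ σ, O ≤ O.comap (Representation.ofDistribMulAction ℤ (E ≃ₐ[K] E) E σ)) :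
    Nat.card (IntertwiningMap σZ (((Representation.ofMulDistribMulAction (E ≃ₐ[K] E) Eˣ).subrepresentation
        Ub hUbst).quotient _ (ModPRepCount.range_lsmul_le_comap
          ((Representation.ofMulDistribMulAction (E ≃ₐ[K] E) Eˣ).subrepresentation Ub hUbst) p))) =
    Nat.card (IntertwiningMap σZ ((((Representation.ofDistribMulAction ℤ (E ≃ₐ[K] E) E).subrepresentation
        O hOst).quotient _ (ModPRepCount.range_lsmul_le_comap
          ((Representation.ofDistribMulAction ℤ (E ≃ₐ[K] E) E).subrepresentation O hOst) p)))) *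
    Nat.card (IntertwiningMap σZ (((Representation.ofMulDistribMulAction (E ≃ₐ[K] E) Eˣ).subrepresentation
        Ub hUbst).subrepresentation _ (ModPRepCount.ker_lsmul_le_comap
          ((Representation.ofMulDistribMulAction (E ≃ₐ[K] E) Eˣ).subrepresentation Ub hUbst) p))) := by
  classical
  haveI : Finite (E ≃ₐ[K] E) := inferInstance
  -- inclusions
  have hle1 : U₁ ≤ Ub := fun u hu =>
    (hUb u).2 ⟨one_le_units p hpv OU U₁ hOU hU₁ hu, nsmul_mem hu _⟩
  have hleO : Ub ≤ OU := fun u hu => ((hUb u).1 hu).1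
  have hpa : ∀ w ∈ Ub, (p : ℤ) ^ a • w ∈ U₁ := fun w hw => by
    rw [← Nat.cast_pow, natCast_zsmul]; exact ((hUb w).1 hw).2
  -- finiteness
  haveI : Finite (LinearMap.ker (LinearMap.lsmul ℤ Ub p)) := finite_ker_lsmul p Ub
  haveI : Finite (LinearMap.ker (LinearMap.lsmul ℤ U₁ p)) := finite_ker_lsmul p U₁
  haveI : Finite (U₁ ⧸ LinearMap.range (LinearMap.lsmul ℤ U₁ p)) :=
    finite_quotient_one p hpv U₁ U₂ hU₁ hU₂ hU₁st O hO hOst (K := K)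
  haveI : Finite (OU ⧸ U₁.comap OU.subtype) := finite_units_quotient_one p hpv OU U₁ hOU hU₁
  haveI : Finite (Ub ⧸ U₁.comap Ub.subtype) := by
    have hι : U₁.comap Ub.subtype ≤ (U₁.comap OU.subtype).comap (Submodule.inclusion hleO) :=
      fun u hu => hu
    refine Finite.of_injective ((U₁.comap Ub.subtype).mapQ _ (Submodule.inclusion hleO) hι) ?_
    rw [← LinearMap.ker_eq_bot, Submodule.mapQ, Submodule.ker_liftQ_eq_bot']
    ext u
    simp only [LinearMap.mem_ker, LinearMap.comp_apply, Submodule.mkQ_apply,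
      Submodule.Quotient.mk_eq_zero, Submodule.mem_comap]
    rfl
  haveI : Finite (Ub ⧸ LinearMap.range (LinearMap.lsmul ℤ Ub p)) :=
    finite_quotient_range_lsmul_of_finite p Ub U₁ hle1
  -- Milne 2.12 with torsion for `U♭ ⊇ U₁`
  obtain ⟨-, stepA⟩ := ModPRepCount.natCard_modP_mul_torsion_eq_of_le_pow
    (Representation.ofMulDistribMulAction (E ≃ₐ[K] E) Eˣ) σZ hG hZ Ub hUbst a U₁ hU₁st hle1 hpa
  -- stage B3 for `U₁`
  have stepB := natCard_modP_one p hpv hG σZ hZ U₁ U₂ U₃ hU₁ hU₂ hU₃ hU₁st hU₂st O hO hOst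
  rw [stepB] at stepA
  -- cancel `#Hom(Z, U₁[p]) > 0`
  haveI : Finite (IntertwiningMap σZ (((Representation.ofMulDistribMulAction (E ≃ₐ[K] E) Eˣ).subrepresentation
      U₁ hU₁st).subrepresentation _ (ModPRepCount.ker_lsmul_le_comap
        ((Representation.ofMulDistribMulAction (E ≃ₐ[K] E) Eˣ).subrepresentation U₁ hU₁st) p))) :=
    ModPRepCount.finite_intertwiningMap σZ _
  have hpos : 0 < Nat.card (IntertwiningMap σZ (((Representation.ofMulDistribMulAction (E ≃ₐ[K] E) Eˣ).subrepresentation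
      U₁ hU₁st).subrepresentation _ (ModPRepCount.ker_lsmul_le_comap
        ((Representation.ofMulDistribMulAction (E ≃ₐ[K] E) Eˣ).subrepresentation U₁ hU₁st) p))) :=
    Nat.card_pos
  refine Nat.eq_of_mul_eq_mul_right hpos ?_
  rw [stepA]; ring

end Flat

end OneUnits

end Summit.BirchSwinnertonDyer.Rank1Residual.GaloisImage

end
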